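import Literature.NumberTheory.Rogawski1990.ArchInnerTransferCompatible      -- ★ p826620 (T6a): letter N2 `ArchInnerTransferCompatible` [Shelstad1979 Thm. 4.1 + CD]
import Literature.NumberTheory.Rogawski1990.ArchEndoscopicTransferCompatible  -- ★ p826679 (T6a): letter N3 `ArchEndoscopicTransferCompatible` [Shelstad1982∕83 + CD]
import Literature.NumberTheory.Rogawski1990.ArchExplicitTransferFactor        -- ★ p826337 (T6b): N1a `archExplicitTransferFactor` = print's `Δ″_∞` [§4.9 p. 55; §14.6 p. 242]
import Literature.NumberTheory.Rogawski1990.ArchExplicitTransferFactorNondegenerate  -- ★ p827632 (B-p12 (g25)): (N2∞) closer `isArchNondegenerate_archExplicitTransferFactor`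
import Literature.NumberTheory.Rogawski1990.ArchCompatibleFamiliesExist   -- ★ p827798 (B-p17 (g20)): (M) closer `exists_archCompatibleFamilies`
import Literature.NumberTheory.Automorphic.QuadraticHeckeCharacterCM          -- ★ `quadraticHeckeCharCM` = `ω_{L∕L⁺}` (the μ-guard of print's endoscopic datum, §4.6–4.8)
import Literature.NumberTheory.Automorphic.LocalStableOrbitalFinite            -- ★ `stableOrbitalIntegralRel_smul_fun` (ray transport)
import HarnessLib

/-!
# F0 ∕ P3a — ★ #77 `ArchTransfersExistCanonical` FROM THE STUB TEXTS + RAY TRANSPORT (sorry-free compositions; the importable twin of the Lines workfile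
# `Cruxes/H413/Lines/F0_P3a_ArchTransfersCanonicalPaydown.lean` (T6-L1) ED. 2, tree sha16 dcee307c85ab3214, §0 + §1 (M) + §2 + §1c)
# (cell `hodgecm-mathlib`, crux H413 = `stmt-HodgeConjecture-24833`; F0P3a-p01 (g9) for F0P3-plan (g7), WORD «B, STAGED» 2026-08-31T19:45:22Z)

WHAT THIS FILE IS.  The `sorry`-FREE part of the registered nested pay-down line T6-L1, promoted VERBATIM to `Theorems/` (no `Cruxes/…/Lines/` import):
§0 `isArchNondegenerate_of_ray` (:82), the CLOSED payable (M) `stub_archCompatibleFamilies_exists` (:121, one application of ★ p827798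
`exists_archCompatibleFamilies`), §2 `archTransfersExistCanonical_of_stubs (hM) (hND) (hN2) (hN3)` (:208, the thirteen conjuncts of ★ `ArchTransfersExistCanonical`
from the compatible system of (M), the letters N8 = `hN2 : ArchInnerTransferCompatible …`, N9 = `hN3 : ArchEndoscopicTransferCompatible … T …` BY ★ NAME and the
`T`-clause `hND`), §1c `archEndoscopicTransferCompatible_of_ray` (:366, N9 passes from `T₀` to every `T` on the ray `T.Δ = c · T₀.Δ`), statements and proofs TOKEN
FOR TOKEN; only the namespace differs (`…Cruxes.H413.F0P3aArchTransfersCanonicalOfStubs`).  NOT twinned: the sorried letter stubs N8 :198 ∕ N9″ :353, the heads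
`_holds` :293 ∕ `_holds_ray` :416 (sorryAx), the closed-form `def` :432.  Consumer: the T6-L2 junction twin (after T6-L2 ED. 6) and the rung-0 assembly
`Theorems/F0P3Rung0OfLetters.lean`, which feed `hN2` ∕ `hN3` from the closer's registered letters and move N9 from `Δ″_∞` to `Δ‴_∞ = c(H′)·Δ″_∞` by §1c with
★ `archCanonicalTransferFactor_Δ_eq_mul_explicit`.
HONEST LABEL: HC_CM is proved only modulo the printed citations until rung 0 closes; this file proves implications only and closes no stub; the Lines file stays the
line of record (drift rule F0P3-plan (g7) 19:45:22Z (2)).  Theorems only; no `def`, no instance, no notation; `--kind proof --supports stmt-HodgeConjecture-24833 --as helper`.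

References: [Rogawski1990] §14.2 (14.2.1) pp. 232–233, §14.3 pp. 233–234, §14.6 p. 242, §1.7 p. 6, §4.3 (4.3.1) p. 43; [Shelstad1979] §4 p. 20, Thm. 4.1;
[LanglandsShelstad1987] §1.3–1.4.
-/

set_option autoImplicit false
set_option linter.dupNamespace false

noncomputable section

open NumberField IsDedekindDomain MeasureTheory Measure
open Literature.NumberTheory.Rogawski1990 Literature.NumberTheory.Automorphic Literature.NumberTheory.GaloisRepresentations
open Literature.AlgebraicGeometry.ShimuraVarieties (unitaryGroup hermForm)
-- `Classical`: the place subtypes indexing `mixedSpace L` are `Fintype` classically (`NormedCommRing (mixedSpace L)`), as in ★ `ArchimedeanTransfer`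
open scoped Matrix MatrixGroups Classical

namespace Summit.HodgeConjecture.HodgeConjecture.Cruxes.H413.F0P3aArchTransfersCanonicalOfStubs

/-! ## §0 (v2) Ray transport of non-degeneracy (measure-free) -/

/-- **(R-nd) Non-degeneracy along the ray**: `T.Δ = c · T₀.Δ` with `c ≠ 0` and `T₀` non-degenerate ⇒ `T` non-degenerate. [cite: Rogawski1990, §14.6 p. 242] -/
theorem isArchNondegenerate_of_ray {L : Type} [Field L] [NumberField L] [IsCMField L] {H' : Matrix (Fin 3) (Fin 3) L}
    {T T₀ : ArchTransferFactor L H'} {c : ℂ} (hc : c ≠ 0) (hT : ∀ a b, T.Δ a b = c * T₀.Δ a b)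
    (h₀ : IsArchNondegenerate L H' T₀) : IsArchNondegenerate L H' T := by
  rw [isArchNondegenerate_iff] at h₀ ⊢
  intro γH γ hp hreg
  rw [hT]
  exact mul_ne_zero hc (h₀ γH γ hp hreg)


variable (L : Type) [Field L] [NumberField L] [IsCMField L] (H' : Matrix (Fin 3) (Fin 3) L) (T : ArchTransferFactor L H')
    [MeasurableSpace (UnitaryGroup.arch (↥(maximalRealSubfield L)) L (IsCMField.complexConj L) 3 H')]
    [BorelSpace (UnitaryGroup.arch (↥(maximalRealSubfield L)) L (IsCMField.complexConj L) 3 H')]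
    [MeasurableSpace (UnitaryGroup.arch (↥(maximalRealSubfield L)) L (IsCMField.complexConj L) 3
      (Matrix.of fun i j : Fin 3 => if i.val + j.val + 1 = 3 then (1 : L) else 0))]
    [BorelSpace (UnitaryGroup.arch (↥(maximalRealSubfield L)) L (IsCMField.complexConj L) 3
      (Matrix.of fun i j : Fin 3 => if i.val + j.val + 1 = 3 then (1 : L) else 0))]
    [MeasurableSpace (UnitaryGroup.arch (↥(maximalRealSubfield L)) L (IsCMField.complexConj L) 2
            (Matrix.of fun i j : Fin 2 => if i.val + j.val + 1 = 2 then (1 : L) else 0) ×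
          UnitaryGroup.arch (↥(maximalRealSubfield L)) L (IsCMField.complexConj L) 1
            (Matrix.of fun i j : Fin 1 => if i.val + j.val + 1 = 1 then (1 : L) else 0))]
    [BorelSpace (UnitaryGroup.arch (↥(maximalRealSubfield L)) L (IsCMField.complexConj L) 2
            (Matrix.of fun i j : Fin 2 => if i.val + j.val + 1 = 2 then (1 : L) else 0) ×
          UnitaryGroup.arch (↥(maximalRealSubfield L)) L (IsCMField.complexConj L) 1
            (Matrix.of fun i j : Fin 1 => if i.val + j.val + 1 = 1 then (1 : L) else 0))]
    (ν' : Measure (UnitaryGroup.arch (↥(maximalRealSubfield L)) L (IsCMField.complexConj L) 3 H'))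
    (ν : Measure (UnitaryGroup.arch (↥(maximalRealSubfield L)) L (IsCMField.complexConj L) 3
      (Matrix.of fun i j : Fin 3 => if i.val + j.val + 1 = 3 then (1 : L) else 0)))
    (νH : Measure (UnitaryGroup.arch (↥(maximalRealSubfield L)) L (IsCMField.complexConj L) 2
            (Matrix.of fun i j : Fin 2 => if i.val + j.val + 1 = 2 then (1 : L) else 0) ×
          UnitaryGroup.arch (↥(maximalRealSubfield L)) L (IsCMField.complexConj L) 1
            (Matrix.of fun i j : Fin 1 => if i.val + j.val + 1 = 1 then (1 : L) else 0)))
    [ν'.IsHaarMeasure] [ν'.IsMulRightInvariant] [ν.IsHaarMeasure] [ν.IsMulRightInvariant] [νH.IsHaarMeasure] [νH.IsMulRightInvariant]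


/-! ## §1 The closed payable (M) -/

/-- **STUB (M) — PAYABLE-NOW (L): a Weil-form system of orbital measures with transport-compatible centraliser measures EXISTS** on `G′_∞`, `G_∞`, `H_∞` for the
given Haar measures (print's measure convention is satisfiable: [Rogawski1990 §1.7 p. 6 «compatible measures»; Shelstad1979 §4 p. 20 «the pair `dt′, ψ_x` defines a
measure `dt` on `T`, independently of the choice of `x`»]).  Pure measure theory over ★ O8 `archStableCentralizerEquiv`, ★ `endoEmbArchCentralizer`, Mathlib Haar
measure on the closed tori `Z(γ)`. [cite: Rogawski1990, §1.7 p. 6; §4.3 (4.3.1) p. 43] [cite: Shelstad1979, §4 p. 20] [cite: LanglandsShelstad1987, §1.3–1.4] -/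
theorem stub_archCompatibleFamilies_exists (_hherm : (H'.map (cmConjRingHom L)).transpose = H')
    (hanis : ∀ x : Fin 3 → L, hermForm (cmConjRingHom L) H' x x = 0 → x = 0) :
    letI : ∀ γ : UnitaryGroup.arch (↥(maximalRealSubfield L)) L (IsCMField.complexConj L) 3 H',
        MeasurableSpace (UnitaryGroup.arch (↥(maximalRealSubfield L)) L (IsCMField.complexConj L) 3 H' ⧸
          Subgroup.centralizer ({γ} : Set (UnitaryGroup.arch (↥(maximalRealSubfield L)) L (IsCMField.complexConj L) 3 H'))) :=
      fun _ => borel _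
    haveI : ∀ γ : UnitaryGroup.arch (↥(maximalRealSubfield L)) L (IsCMField.complexConj L) 3 H',
        BorelSpace (UnitaryGroup.arch (↥(maximalRealSubfield L)) L (IsCMField.complexConj L) 3 H' ⧸
          Subgroup.centralizer ({γ} : Set (UnitaryGroup.arch (↥(maximalRealSubfield L)) L (IsCMField.complexConj L) 3 H'))) :=
      fun _ => ⟨rfl⟩
    letI : ∀ γ : UnitaryGroup.arch (↥(maximalRealSubfield L)) L (IsCMField.complexConj L) 3
          (Matrix.of fun i j : Fin 3 => if i.val + j.val + 1 = 3 then (1 : L) else 0),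
        MeasurableSpace (UnitaryGroup.arch (↥(maximalRealSubfield L)) L (IsCMField.complexConj L) 3
            (Matrix.of fun i j : Fin 3 => if i.val + j.val + 1 = 3 then (1 : L) else 0) ⧸
          Subgroup.centralizer ({γ} : Set (UnitaryGroup.arch (↥(maximalRealSubfield L)) L (IsCMField.complexConj L) 3
            (Matrix.of fun i j : Fin 3 => if i.val + j.val + 1 = 3 then (1 : L) else 0)))) :=
      fun _ => borel _
    haveI : ∀ γ : UnitaryGroup.arch (↥(maximalRealSubfield L)) L (IsCMField.complexConj L) 3
          (Matrix.of fun i j : Fin 3 => if i.val + j.val + 1 = 3 then (1 : L) else 0),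
        BorelSpace (UnitaryGroup.arch (↥(maximalRealSubfield L)) L (IsCMField.complexConj L) 3
            (Matrix.of fun i j : Fin 3 => if i.val + j.val + 1 = 3 then (1 : L) else 0) ⧸
          Subgroup.centralizer ({γ} : Set (UnitaryGroup.arch (↥(maximalRealSubfield L)) L (IsCMField.complexConj L) 3
            (Matrix.of fun i j : Fin 3 => if i.val + j.val + 1 = 3 then (1 : L) else 0)))) :=
      fun _ => ⟨rfl⟩
    letI : ∀ a : (UnitaryGroup.arch (↥(maximalRealSubfield L)) L (IsCMField.complexConj L) 2
          (Matrix.of fun i j : Fin 2 => if i.val + j.val + 1 = 2 then (1 : L) else 0) ×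
        UnitaryGroup.arch (↥(maximalRealSubfield L)) L (IsCMField.complexConj L) 1
          (Matrix.of fun i j : Fin 1 => if i.val + j.val + 1 = 1 then (1 : L) else 0)),
        MeasurableSpace ((UnitaryGroup.arch (↥(maximalRealSubfield L)) L (IsCMField.complexConj L) 2
            (Matrix.of fun i j : Fin 2 => if i.val + j.val + 1 = 2 then (1 : L) else 0) ×
          UnitaryGroup.arch (↥(maximalRealSubfield L)) L (IsCMField.complexConj L) 1
            (Matrix.of fun i j : Fin 1 => if i.val + j.val + 1 = 1 then (1 : L) else 0)) ⧸
          Subgroup.centralizer ({a} : Set (UnitaryGroup.arch (↥(maximalRealSubfield L)) L (IsCMField.complexConj L) 2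
            (Matrix.of fun i j : Fin 2 => if i.val + j.val + 1 = 2 then (1 : L) else 0) ×
          UnitaryGroup.arch (↥(maximalRealSubfield L)) L (IsCMField.complexConj L) 1
            (Matrix.of fun i j : Fin 1 => if i.val + j.val + 1 = 1 then (1 : L) else 0)))) :=
      fun _ => borel _
    haveI : ∀ a : (UnitaryGroup.arch (↥(maximalRealSubfield L)) L (IsCMField.complexConj L) 2
          (Matrix.of fun i j : Fin 2 => if i.val + j.val + 1 = 2 then (1 : L) else 0) ×
        UnitaryGroup.arch (↥(maximalRealSubfield L)) L (IsCMField.complexConj L) 1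
          (Matrix.of fun i j : Fin 1 => if i.val + j.val + 1 = 1 then (1 : L) else 0)),
        BorelSpace ((UnitaryGroup.arch (↥(maximalRealSubfield L)) L (IsCMField.complexConj L) 2
            (Matrix.of fun i j : Fin 2 => if i.val + j.val + 1 = 2 then (1 : L) else 0) ×
          UnitaryGroup.arch (↥(maximalRealSubfield L)) L (IsCMField.complexConj L) 1
            (Matrix.of fun i j : Fin 1 => if i.val + j.val + 1 = 1 then (1 : L) else 0)) ⧸
          Subgroup.centralizer ({a} : Set (UnitaryGroup.arch (↥(maximalRealSubfield L)) L (IsCMField.complexConj L) 2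
            (Matrix.of fun i j : Fin 2 => if i.val + j.val + 1 = 2 then (1 : L) else 0) ×
          UnitaryGroup.arch (↥(maximalRealSubfield L)) L (IsCMField.complexConj L) 1
            (Matrix.of fun i j : Fin 1 => if i.val + j.val + 1 = 1 then (1 : L) else 0)))) :=
      fun _ => ⟨rfl⟩
    ∃ (m' : OrbitalMeasureFamily (UnitaryGroup.arch (↥(maximalRealSubfield L)) L (IsCMField.complexConj L) 3 H'))
      (m : OrbitalMeasureFamily (UnitaryGroup.arch (↥(maximalRealSubfield L)) L (IsCMField.complexConj L) 3
        (Matrix.of fun i j : Fin 3 => if i.val + j.val + 1 = 3 then (1 : L) else 0)))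
      (mH : OrbitalMeasureFamily (UnitaryGroup.arch (↥(maximalRealSubfield L)) L (IsCMField.complexConj L) 2
          (Matrix.of fun i j : Fin 2 => if i.val + j.val + 1 = 2 then (1 : L) else 0) ×
        UnitaryGroup.arch (↥(maximalRealSubfield L)) L (IsCMField.complexConj L) 1
          (Matrix.of fun i j : Fin 1 => if i.val + j.val + 1 = 1 then (1 : L) else 0)))
      (t' : ∀ γ' : UnitaryGroup.arch (↥(maximalRealSubfield L)) L (IsCMField.complexConj L) 3 H',
        Measure (Subgroup.centralizer ({γ'} : Set (UnitaryGroup.arch (↥(maximalRealSubfield L)) L (IsCMField.complexConj L) 3 H'))))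
      (t : ∀ γ : UnitaryGroup.arch (↥(maximalRealSubfield L)) L (IsCMField.complexConj L) 3
          (Matrix.of fun i j : Fin 3 => if i.val + j.val + 1 = 3 then (1 : L) else 0),
        Measure (Subgroup.centralizer ({γ} : Set (UnitaryGroup.arch (↥(maximalRealSubfield L)) L (IsCMField.complexConj L) 3
          (Matrix.of fun i j : Fin 3 => if i.val + j.val + 1 = 3 then (1 : L) else 0)))))
      (tH : ∀ γH : UnitaryGroup.arch (↥(maximalRealSubfield L)) L (IsCMField.complexConj L) 2
            (Matrix.of fun i j : Fin 2 => if i.val + j.val + 1 = 2 then (1 : L) else 0) ×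
          UnitaryGroup.arch (↥(maximalRealSubfield L)) L (IsCMField.complexConj L) 1
            (Matrix.of fun i j : Fin 1 => if i.val + j.val + 1 = 1 then (1 : L) else 0),
        Measure (Subgroup.centralizer ({γH} : Set (UnitaryGroup.arch (↥(maximalRealSubfield L)) L (IsCMField.complexConj L) 2
            (Matrix.of fun i j : Fin 2 => if i.val + j.val + 1 = 2 then (1 : L) else 0) ×
          UnitaryGroup.arch (↥(maximalRealSubfield L)) L (IsCMField.complexConj L) 1
            (Matrix.of fun i j : Fin 1 => if i.val + j.val + 1 = 1 then (1 : L) else 0))))),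
      ArchCompatibleFamiliesG L H' ν' ν hanis m' m t' t ∧ ArchCompatibleFamiliesH L νH mH tH t :=
  exists_archCompatibleFamilies L H' ν' ν νH hanis

/-! ## §2 The kernel-checked composition: (M) + (ND) + N2 + N3 ⟹ ★ #77 BY NAME (no `sorry`) -/

variable {L H' T ν' ν νH}

/-- **`ArchTransfersExistCanonical` FROM THE STUB TEXTS** (composition; `sorry`-free): open the compatible system of (M); conjuncts (i)(ii)(iii) are the Haar riders of
★ `ArchCompatibleFamilies` (ED. 2 p826563); (iv) = (ND); (v) = N2 at the system; (vi) = N3 at the system; (W′)(W)(W_H)(C′)(C)(C′G)(C_H) = the system's own clauses.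
[cite: Rogawski1990, §14.2 (14.2.1) pp. 232–233; §14.3 pp. 233–234; §4.9 Prop. 4.9.1 (a) p. 55; §1.7 p. 6] -/
theorem archTransfersExistCanonical_of_stubs
    (hM : ∀ (hherm : (H'.map (cmConjRingHom L)).transpose = H') (hanis : ∀ x : Fin 3 → L, hermForm (cmConjRingHom L) H' x x = 0 → x = 0),
      letI : ∀ γ : UnitaryGroup.arch (↥(maximalRealSubfield L)) L (IsCMField.complexConj L) 3 H',
          MeasurableSpace (UnitaryGroup.arch (↥(maximalRealSubfield L)) L (IsCMField.complexConj L) 3 H' ⧸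
            Subgroup.centralizer ({γ} : Set (UnitaryGroup.arch (↥(maximalRealSubfield L)) L (IsCMField.complexConj L) 3 H'))) :=
        fun _ => borel _
      haveI : ∀ γ : UnitaryGroup.arch (↥(maximalRealSubfield L)) L (IsCMField.complexConj L) 3 H',
          BorelSpace (UnitaryGroup.arch (↥(maximalRealSubfield L)) L (IsCMField.complexConj L) 3 H' ⧸
            Subgroup.centralizer ({γ} : Set (UnitaryGroup.arch (↥(maximalRealSubfield L)) L (IsCMField.complexConj L) 3 H'))) :=
        fun _ => ⟨rfl⟩
      letI : ∀ γ : UnitaryGroup.arch (↥(maximalRealSubfield L)) L (IsCMField.complexConj L) 3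
            (Matrix.of fun i j : Fin 3 => if i.val + j.val + 1 = 3 then (1 : L) else 0),
          MeasurableSpace (UnitaryGroup.arch (↥(maximalRealSubfield L)) L (IsCMField.complexConj L) 3
              (Matrix.of fun i j : Fin 3 => if i.val + j.val + 1 = 3 then (1 : L) else 0) ⧸
            Subgroup.centralizer ({γ} : Set (UnitaryGroup.arch (↥(maximalRealSubfield L)) L (IsCMField.complexConj L) 3
              (Matrix.of fun i j : Fin 3 => if i.val + j.val + 1 = 3 then (1 : L) else 0)))) :=
        fun _ => borel _
      haveI : ∀ γ : UnitaryGroup.arch (↥(maximalRealSubfield L)) L (IsCMField.complexConj L) 3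
            (Matrix.of fun i j : Fin 3 => if i.val + j.val + 1 = 3 then (1 : L) else 0),
          BorelSpace (UnitaryGroup.arch (↥(maximalRealSubfield L)) L (IsCMField.complexConj L) 3
              (Matrix.of fun i j : Fin 3 => if i.val + j.val + 1 = 3 then (1 : L) else 0) ⧸
            Subgroup.centralizer ({γ} : Set (UnitaryGroup.arch (↥(maximalRealSubfield L)) L (IsCMField.complexConj L) 3
              (Matrix.of fun i j : Fin 3 => if i.val + j.val + 1 = 3 then (1 : L) else 0)))) :=
        fun _ => ⟨rfl⟩
      letI : ∀ a : (UnitaryGroup.arch (↥(maximalRealSubfield L)) L (IsCMField.complexConj L) 2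
            (Matrix.of fun i j : Fin 2 => if i.val + j.val + 1 = 2 then (1 : L) else 0) ×
          UnitaryGroup.arch (↥(maximalRealSubfield L)) L (IsCMField.complexConj L) 1
            (Matrix.of fun i j : Fin 1 => if i.val + j.val + 1 = 1 then (1 : L) else 0)),
          MeasurableSpace ((UnitaryGroup.arch (↥(maximalRealSubfield L)) L (IsCMField.complexConj L) 2
              (Matrix.of fun i j : Fin 2 => if i.val + j.val + 1 = 2 then (1 : L) else 0) ×
            UnitaryGroup.arch (↥(maximalRealSubfield L)) L (IsCMField.complexConj L) 1
              (Matrix.of fun i j : Fin 1 => if i.val + j.val + 1 = 1 then (1 : L) else 0)) ⧸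
            Subgroup.centralizer ({a} : Set (UnitaryGroup.arch (↥(maximalRealSubfield L)) L (IsCMField.complexConj L) 2
              (Matrix.of fun i j : Fin 2 => if i.val + j.val + 1 = 2 then (1 : L) else 0) ×
            UnitaryGroup.arch (↥(maximalRealSubfield L)) L (IsCMField.complexConj L) 1
              (Matrix.of fun i j : Fin 1 => if i.val + j.val + 1 = 1 then (1 : L) else 0)))) :=
        fun _ => borel _
      haveI : ∀ a : (UnitaryGroup.arch (↥(maximalRealSubfield L)) L (IsCMField.complexConj L) 2
            (Matrix.of fun i j : Fin 2 => if i.val + j.val + 1 = 2 then (1 : L) else 0) ×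
          UnitaryGroup.arch (↥(maximalRealSubfield L)) L (IsCMField.complexConj L) 1
            (Matrix.of fun i j : Fin 1 => if i.val + j.val + 1 = 1 then (1 : L) else 0)),
          BorelSpace ((UnitaryGroup.arch (↥(maximalRealSubfield L)) L (IsCMField.complexConj L) 2
              (Matrix.of fun i j : Fin 2 => if i.val + j.val + 1 = 2 then (1 : L) else 0) ×
            UnitaryGroup.arch (↥(maximalRealSubfield L)) L (IsCMField.complexConj L) 1
              (Matrix.of fun i j : Fin 1 => if i.val + j.val + 1 = 1 then (1 : L) else 0)) ⧸
            Subgroup.centralizer ({a} : Set (UnitaryGroup.arch (↥(maximalRealSubfield L)) L (IsCMField.complexConj L) 2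
              (Matrix.of fun i j : Fin 2 => if i.val + j.val + 1 = 2 then (1 : L) else 0) ×
            UnitaryGroup.arch (↥(maximalRealSubfield L)) L (IsCMField.complexConj L) 1
              (Matrix.of fun i j : Fin 1 => if i.val + j.val + 1 = 1 then (1 : L) else 0)))) :=
        fun _ => ⟨rfl⟩
      ∃ (m' : OrbitalMeasureFamily (UnitaryGroup.arch (↥(maximalRealSubfield L)) L (IsCMField.complexConj L) 3 H'))
        (m : OrbitalMeasureFamily (UnitaryGroup.arch (↥(maximalRealSubfield L)) L (IsCMField.complexConj L) 3
          (Matrix.of fun i j : Fin 3 => if i.val + j.val + 1 = 3 then (1 : L) else 0)))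
        (mH : OrbitalMeasureFamily (UnitaryGroup.arch (↥(maximalRealSubfield L)) L (IsCMField.complexConj L) 2
            (Matrix.of fun i j : Fin 2 => if i.val + j.val + 1 = 2 then (1 : L) else 0) ×
          UnitaryGroup.arch (↥(maximalRealSubfield L)) L (IsCMField.complexConj L) 1
            (Matrix.of fun i j : Fin 1 => if i.val + j.val + 1 = 1 then (1 : L) else 0)))
        (t' : ∀ γ' : UnitaryGroup.arch (↥(maximalRealSubfield L)) L (IsCMField.complexConj L) 3 H',
          Measure (Subgroup.centralizer ({γ'} : Set (UnitaryGroup.arch (↥(maximalRealSubfield L)) L (IsCMField.complexConj L) 3 H'))))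
        (t : ∀ γ : UnitaryGroup.arch (↥(maximalRealSubfield L)) L (IsCMField.complexConj L) 3
            (Matrix.of fun i j : Fin 3 => if i.val + j.val + 1 = 3 then (1 : L) else 0),
          Measure (Subgroup.centralizer ({γ} : Set (UnitaryGroup.arch (↥(maximalRealSubfield L)) L (IsCMField.complexConj L) 3
            (Matrix.of fun i j : Fin 3 => if i.val + j.val + 1 = 3 then (1 : L) else 0)))))
        (tH : ∀ γH : UnitaryGroup.arch (↥(maximalRealSubfield L)) L (IsCMField.complexConj L) 2
              (Matrix.of fun i j : Fin 2 => if i.val + j.val + 1 = 2 then (1 : L) else 0) ×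
            UnitaryGroup.arch (↥(maximalRealSubfield L)) L (IsCMField.complexConj L) 1
              (Matrix.of fun i j : Fin 1 => if i.val + j.val + 1 = 1 then (1 : L) else 0),
          Measure (Subgroup.centralizer ({γH} : Set (UnitaryGroup.arch (↥(maximalRealSubfield L)) L (IsCMField.complexConj L) 2
              (Matrix.of fun i j : Fin 2 => if i.val + j.val + 1 = 2 then (1 : L) else 0) ×
            UnitaryGroup.arch (↥(maximalRealSubfield L)) L (IsCMField.complexConj L) 1
              (Matrix.of fun i j : Fin 1 => if i.val + j.val + 1 = 1 then (1 : L) else 0))))),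
        ArchCompatibleFamiliesG L H' ν' ν hanis m' m t' t ∧ ArchCompatibleFamiliesH L νH mH tH t)
    (hND : (H'.map (cmConjRingHom L)).transpose = H' → (∀ x : Fin 3 → L, hermForm (cmConjRingHom L) H' x x = 0 → x = 0) → IsArchNondegenerate L H' T)
    (hN2 : ArchInnerTransferCompatible L H' ν' ν) (hN3 : ArchEndoscopicTransferCompatible L H' T ν' ν νH) :
    ArchTransfersExistCanonical L H' T ν' ν νH := by
  intro hherm hanis
  obtain ⟨m', m, mH, t', t, tH, hG, hH⟩ := hM hherm hanis
  exact ⟨m', m, mH, t', t, tH, hG.isAdmissibleOn_inner, hG.isAdmissibleOn_quasiSplit, hH.isAdmissibleOn, hND hherm hanis,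
    hN2 hherm hanis m' m t' t hG, hN3 hherm hanis m' m mH t' t tH hG hH, hG.1, hG.2.1, hH.1, hG.2.2.1, hG.2.2.2.1, hG.2.2.2.2, hH.2⟩


/-! ## §1c (v2) RAY TRANSPORT — PROVED: the two `T`-clauses pass from `T₀` to every `T` with `T.Δ = c · T₀.Δ`, `c ≠ 0` (node R of T6a-TREE §2) -/

-- (the Lines file re-opens `variable {L H' T ν' ν νH}` here after its explicit §2-head block; in this twin they are still implicit)

/-- **(R-tr) The endoscopic-transfer letter along the ray**: if `a′ ↦ a^H` relative to `T₀` then `a′ ↦ c • a^H` relative to `T` with `T.Δ = c · T₀.Δ` (★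
`stableOrbitalIntegralRel_smul_fun`, Mathlib `mul_finsum`; `C_c^∞(H_∞)` is closed under scalars — ★ `archSmooth` is a submodule). [cite: Rogawski1990, §14.6 p. 242
«Δ′_v = c_v Δ″_v»; §14.3 pp. 233–234] -/
theorem archEndoscopicTransferCompatible_of_ray {T₀ : ArchTransferFactor L H'} {c : ℂ} (hT : ∀ a b, T.Δ a b = c * T₀.Δ a b)
    (h₀ : ArchEndoscopicTransferCompatible L H' T₀ ν' ν νH) : ArchEndoscopicTransferCompatible L H' T ν' ν νH := by
  intro hherm hanis m' m mH t' t tH hG hH a' ha'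
  obtain ⟨aH, haH, htr⟩ := h₀ hherm hanis m' m mH t' t tH hG hH a' ha'
  refine ⟨c • aH, ?_, ?_⟩
  · obtain ⟨φ, hφc, hφs, hφsm, hφ⟩ := haH
    refine ⟨c • φ, hφc.const_smul c, hφs.mono (Function.support_const_smul_subset c φ),
      (mem_archSmooth_iff _ _).1 (Submodule.smul_mem _ c ((mem_archSmooth_iff _ _).2 hφsm)), fun k => ?_⟩
    simp only [Pi.smul_apply, hφ k]
  · -- the `H_∞` orbit-quotient σ-algebras are `borel` (fixed inside the letters); make them the local instances before rewriting (T6a-TREE §4 (T))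
    letI : ∀ a : (UnitaryGroup.arch (↥(maximalRealSubfield L)) L (IsCMField.complexConj L) 2 (Matrix.of fun i j : Fin 2 => if i.val + j.val + 1 = 2 then (1 : L) else 0) × UnitaryGroup.arch (↥(maximalRealSubfield L)) L (IsCMField.complexConj L) 1 (Matrix.of fun i j : Fin 1 => if i.val + j.val + 1 = 1 then (1 : L) else 0)),
        MeasurableSpace ((UnitaryGroup.arch (↥(maximalRealSubfield L)) L (IsCMField.complexConj L) 2 (Matrix.of fun i j : Fin 2 => if i.val + j.val + 1 = 2 then (1 : L) else 0) × UnitaryGroup.arch (↥(maximalRealSubfield L)) L (IsCMField.complexConj L) 1 (Matrix.of fun i j : Fin 1 => if i.val + j.val + 1 = 1 then (1 : L) else 0)) ⧸ Subgroup.centralizer ({a} : Set (UnitaryGroup.arch (↥(maximalRealSubfield L)) L (IsCMField.complexConj L) 2 (Matrix.of fun i j : Fin 2 => if i.val + j.val + 1 = 2 then (1 : L) else 0) × UnitaryGroup.arch (↥(maximalRealSubfield L)) L (IsCMField.complexConj L) 1 (Matrix.of fun i j : Fin 1 => if i.val + j.val + 1 = 1 then (1 : L) else 0)))) :=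
      fun _ => borel _
    haveI : ∀ a : (UnitaryGroup.arch (↥(maximalRealSubfield L)) L (IsCMField.complexConj L) 2 (Matrix.of fun i j : Fin 2 => if i.val + j.val + 1 = 2 then (1 : L) else 0) × UnitaryGroup.arch (↥(maximalRealSubfield L)) L (IsCMField.complexConj L) 1 (Matrix.of fun i j : Fin 1 => if i.val + j.val + 1 = 1 then (1 : L) else 0)),
        BorelSpace ((UnitaryGroup.arch (↥(maximalRealSubfield L)) L (IsCMField.complexConj L) 2 (Matrix.of fun i j : Fin 2 => if i.val + j.val + 1 = 2 then (1 : L) else 0) × UnitaryGroup.arch (↥(maximalRealSubfield L)) L (IsCMField.complexConj L) 1 (Matrix.of fun i j : Fin 1 => if i.val + j.val + 1 = 1 then (1 : L) else 0)) ⧸ Subgroup.centralizer ({a} : Set (UnitaryGroup.arch (↥(maximalRealSubfield L)) L (IsCMField.complexConj L) 2 (Matrix.of fun i j : Fin 2 => if i.val + j.val + 1 = 2 then (1 : L) else 0) × UnitaryGroup.arch (↥(maximalRealSubfield L)) L (IsCMField.complexConj L) 1 (Matrix.of fun i j : Fin 1 => if i.val + j.val + 1 = 1 then (1 : L) else 0))))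 :=
      fun _ => ⟨rfl⟩
    intro γH hγ
    rw [stableOrbitalIntegralRel_smul_fun, htr γH hγ, mul_finsum]
    refine finsum_congr fun c' => ?_
    rw [hT]
    ring


end Summit.HodgeConjecture.HodgeConjecture.Cruxes.H413.F0P3aArchTransfersCanonicalOfStubs

end
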